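/-
Copyright (c) 2026 the pub-hodgecm-mathlib formalisation cell (harness21).  Prover seat hodgecm-mathlib-B-p14 (g31), (F11) LAYER B′ FILE 3 (iv): Prop. 16's per-`m`
count in the regime `2m ≤ N` and the empty tail `m > N` (DESIGN v3 §FILE 3 of B-p14 (g30); design pen A-p13 (g30); architect A-p06 (g26)), 2026-09-01.
-/
import Literature.NumberTheory.Automorphic.UnitOrbitalIntegralUnfoldingAnisotropic        -- ★ p841407 (F2′): `smul_mk_eq_iff_flickerDiag` (the summand's predicate)
import Literature.NumberTheory.Automorphic.UnitaryThreeAnisotropicFixedPointCriterion      -- ★ p841757 (ii-a): `fixedPoint_mem_unitaryInt_iff`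
import Literature.NumberTheory.Automorphic.UnitaryThreeAnisotropicFixedPointRegimes        -- ★ p841739 (ii-b): `fixedPoint_cond01_iff`, `fixedPoint_cond00_iff_of_two_mul_le`
import Literature.NumberTheory.Automorphic.UnitaryThreeAnisotropicStabilizerCoordinates    -- ★ p841641 (A-p13 FILE 1): `r = −Aσq∕σs`, `det M_h = A∕σs`
import HarnessLib

/-!
# Flicker's Proposition 16, step (iv): the number of `t`-fixed cosets in `Stab(w₀) ⧸ H′_m` — ALL or NONE in the regime `2m ≤ N`, NONE for `m > N`
# (Flicker 1998, Prop. 16 p. 96: first row `0 ≤ m ≤ min([N∕2],[N₂∕2])` and «which means `0 ≤ m ≤ N`»)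

Topic `NumberTheory/Automorphic`; namespace `Literature.NumberTheory.Automorphic.UnitaryGroup`.  THEOREMS ONLY (no `def`, no instance, no notation, no named fact,
no `sorry`; count-neutral).  Cell `pub/hodgecm-mathlib`, crux H413 = `stmt-HodgeConjecture-24833`, road «N7-ns COUNT FROM FLICKER» (architect A-p06 (g26)), line
«N7nsCount» ED. 1.4′, value stub `stub_irredGValueNeg` (κ = −1), LAYER B′ = Prop. 16's count of the `t`-fixed cosets `hH′_m ∈ S ⧸ H′_m`, `S = Stab(w₀)`,
`H′_m = S ∩ d_m K₀ d_m⁻¹` — the summands of ★ (F2′) `natCard_fixedPoints_unitaryInt_eq_finsum_flickerDiag`.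

For `t ∈ S` with (C′) coordinates `(b_t, q_t, r_t, s_t)`, `A_t = 1 + 4ϖb_t`, carrying the TYPE-(2) SIZES `|q_t| = |ϖ|^N`, `|A_t − s_t| ≤ |ϖ|^{N+1}` (★ Bounds ED. 2
`v_q_eq_and_v_sub_le_of_v_disc`: forced by `ord(disc) = 2N+1`):
* `smul_mk_eq_mk_iff_le_and_cond00` — pointwise: `t • hH′_m = hH′_m ↔ m ≤ N ∧ |bracket₀₀(h)| ≤ |ϖ^{2m+1}|` (★ (F2′) + ★ (ii-a) + ★ (ii-b) condition 1 + the determinant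
  factorisation ★ `fixedPoint_expr00_eq_det_mul`, `|Δ_h| = 1`);
* **`natCard_fixedPoints_stabilizer_quotient_eq_zero_of_lt`** — `N < m ⇒ #{z ∈ S ⧸ H′_m : t • z = z} = 0` (condition 1 fails for every `h`);
* **`natCard_fixedPoints_stabilizer_quotient_eq_ite_of_two_mul_le`** — `2m ≤ N ⇒ #{z : t • z = z} = if |A_t − 1| ≤ |ϖ^{2m+1}| then #(S ⧸ H′_m) else 0`
  (condition 2 is `h`-INDEPENDENT in this regime, ★ `fixedPoint_cond00_iff_of_two_mul_le`), i.e. Prop. 16's first row up to the index `#(S ⧸ H′_m) = (q+1)q^{4m}`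
  (A-p13 (g30) FILE 2e-β `natCard_stabilizer_quotient_conjInt_eq`, by name downstream) and the dictionary `|A_t − 1| ≤ |ϖ^{2m+1}| ⟺ 2m+1 ≤ M` (`M = ord(A_t − 1)`);
* **`natCard_fixedPoints_stabilizer_quotient_eq_ite_of_lt_v_sub_one`** — when `|A_t − 1| > |ϖ|^{N+1}` (`M ≤ N`, Flicker's `N₂ < N`) the same all-or-none holds for
  EVERY `m` (`v_bracket_sub_sub_le`, `fixedPoint_cond00_iff_of_lt_v_sub_one`): `#{z : t • z = z} = if m ≤ N ∧ |A_t − 1| ≤ |ϖ^{2m+1}| then #(S ⧸ H′_m) else 0`.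
So only the cell `N < M ∧ [N∕2] < m ≤ N` (one σ-semilinear congruence, count `(q+1)q^{N+2m}`) is left — B-p10 (g25)'s FILE 3 (iii); the per-`m` table `iSixteenM` and the
`Σᶠ_m` are the sequel.
HONEST LABEL: HC_CM is proved only modulo the printed citations until rung 0 closes; structure theory feeding ONE value stub of #103-ns, pays nothing by itself.

## References
* [Flicker1998UnitaryFL] Y. Z. Flicker, *Elementary proof of the fundamental lemma for a unitary group*, Canad. J. Math. 50 (1998), Prop. 5 p. 82, Prop. 16 p. 96,
  Prop. 17 p. 97.
-/

set_option autoImplicit false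

noncomputable section

open scoped MatrixGroups WithZero
open Matrix

namespace Literature.NumberTheory.Automorphic

namespace UnitaryGroup

open Literature.NumberTheory.Automorphic.HermitianLattice

variable {K : Type*} [Field K] [Valued K ℤᵐ⁰] {ϖ : K}
  (σ : K →+* K) {J : Matrix (Fin 3) (Fin 3) K} (hJ : J = (StdForm.antidiagonal 3).over K)

/-! ## §1 The second expression of the criterion is `Δ_h ×` the bracket of ★ (ii-b), and `|Δ_h| = 1` -/

include hJ in
/-- For `t, h ∈ Stab(w₀)`: the second expression of ★ `fixedPoint_mem_unitaryInt_iff` has the valuation of the bracket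
`(A_t − 1) − 4ϖ(A_t − s_t)(σq·q) − 4ϖ(q_tσq s − (A_t∕σs_t)(σq_t q σs))` of ★ `fixedPoint_cond00_iff_of_two_mul_le` (factor `Δ_h = A∕σs`, a unit).
[cite: Flicker1998UnitaryFL, Prop. 16 p. 96] -/
theorem v_fixedPoint_expr00_eq_v_bracket (hd : LocalConjDatum σ ϖ) {t h : ↥(unitaryGroupOfForm σ J)} {bt qt rt st b q r s : K}
    (ht : ((t : GL (Fin 3) K) : Matrix (Fin 3) (Fin 3) K) =
      !![1 + 2 * ϖ * bt, qt, bt; 2 * ϖ * rt, st, rt; 4 * ϖ ^ 2 * bt, 2 * ϖ * qt, 1 + 2 * ϖ * bt])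
    (hh : ((h : GL (Fin 3) K) : Matrix (Fin 3) (Fin 3) K) = !![1 + 2 * ϖ * b, q, b; 2 * ϖ * r, s, r; 4 * ϖ ^ 2 * b, 2 * ϖ * q, 1 + 2 * ϖ * b]) :
    Valued.v (s * ((1 + 4 * ϖ * bt) * (1 + 4 * ϖ * b) + qt * (4 * ϖ * r)) - q * (4 * ϖ * rt * (1 + 4 * ϖ * b) + st * (4 * ϖ * r)) -
        ((1 + 4 * ϖ * b) * s - 4 * ϖ * q * r)) =
      Valued.v (((1 + 4 * ϖ * bt) - 1) - 4 * ϖ * ((1 + 4 * ϖ * bt) - st) * (σ q * q) -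
        4 * ϖ * (qt * σ q * s - (1 + 4 * ϖ * bt) / σ st * (σ qt * q * σ s))) := by
  obtain ⟨hs1, -, hA1, -⟩ := stabilizer_valuation_bounds σ hJ hd hh
  obtain ⟨hst1, -, -, -⟩ := stabilizer_valuation_bounds σ hJ hd ht
  obtain ⟨-, hU2, -⟩ := stabilizer_unitarity_relations σ hJ hd hh
  have hvσ := hd.vσ
  have hA0 : (1 + 4 * ϖ * b) ≠ 0 := fun h0 => by rw [h0, map_zero] at hA1; exact zero_ne_one hA1
  have hσs0 : σ s ≠ 0 := fun h0 => by
    have h1 : Valued.v (σ s) = 1 := by rw [hvσ, hs1]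
    rw [h0, map_zero] at h1; exact zero_ne_one h1
  have hσst0 : σ st ≠ 0 := fun h0 => by
    have h1 : Valued.v (σ st) = 1 := by rw [hvσ, hst1]
    rw [h0, map_zero] at h1; exact zero_ne_one h1
  have hr := stabilizer_r_eq σ hJ hd hh
  have hrt := stabilizer_r_eq σ hJ hd ht
  have hρ : 4 * ϖ * r = -(4 * ϖ * (1 + 4 * ϖ * b) * σ q) / σ s := by rw [hr]; ring
  have hρt : 4 * ϖ * rt = -(4 * ϖ * (1 + 4 * ϖ * bt) * σ qt) / σ st := by rw [hrt]; ring
  have hΔ : (1 + 4 * ϖ * b) * s - 4 * ϖ * r * q = (1 + 4 * ϖ * b) / σ s := by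
    have hdet := det_stabilizerModel_eq σ hJ hd hh
    rw [Matrix.det_fin_two_of] at hdet
    linear_combination hdet
  have key := fixedPoint_expr00_eq_det_mul σ ϖ hA0 hσs0 hσst0 hΔ hρ hρt hU2
  have hcomm : (1 + 4 * ϖ * b) * s - 4 * ϖ * q * r = (1 + 4 * ϖ * b) * s - 4 * ϖ * r * q := by ring
  rw [hcomm, key, map_mul, hΔ, map_div₀, hA1, hvσ, hs1, div_one, one_mul]

/-! ## §2 The pointwise criterion on `S ⧸ H′_m` under the type-(2) sizes -/

set_option synthInstance.maxHeartbeats 200000 in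
-- the `S`-action on `S ⧸ H′_m` is found through the large subgroup terms of the `U(2,1)` frame (as in ★ (F2′))
include hJ in
/-- **POINTWISE**: for `t ∈ S` of type-(2) sizes `|q_t| = |ϖ|^N`, `|A_t − s_t| ≤ |ϖ|^{N+1}` and `h ∈ S` with coordinates `(b, q, r, s)`:
`t • hH′_m = hH′_m ↔ m ≤ N ∧ |bracket₀₀(h)| ≤ |ϖ^{2m+1}|`. [cite: Flicker1998UnitaryFL, Prop. 5 p. 82; Prop. 16 p. 96] -/
theorem smul_mk_eq_mk_iff_le_and_cond00 (hd : LocalConjDatum σ ϖ) (d : ℕ → ↥(unitaryGroupOfForm σ J)) (m : ℕ)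
    (hdm : ((d m : GL (Fin 3) K) : Matrix (Fin 3) (Fin 3) K) = !![ϖ ^ m, 0, 0; 0, 1, 0; 0, 0, (ϖ ^ m)⁻¹])
    {t : ↥(unitaryGroupOfForm σ J)} (htS : t ∈ MulAction.stabilizer (↥(unitaryGroupOfForm σ J)) (![1, 0, -(2 * ϖ)] : Fin 3 → K))
    {bt qt rt st : K}
    (ht : ((t : GL (Fin 3) K) : Matrix (Fin 3) (Fin 3) K) =
      !![1 + 2 * ϖ * bt, qt, bt; 2 * ϖ * rt, st, rt; 4 * ϖ ^ 2 * bt, 2 * ϖ * qt, 1 + 2 * ϖ * bt])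
    (N : ℕ) (hqt : Valued.v qt = WithZero.exp (-(N : ℤ))) (hAst : Valued.v ((1 + 4 * ϖ * bt) - st) ≤ WithZero.exp (-((N : ℤ) + 1)))
    (h : ↥(MulAction.stabilizer (↥(unitaryGroupOfForm σ J)) (![1, 0, -(2 * ϖ)] : Fin 3 → K))) {b q r s : K}
    (hh : (((h : ↥(unitaryGroupOfForm σ J)) : GL (Fin 3) K) : Matrix (Fin 3) (Fin 3) K) =
      !![1 + 2 * ϖ * b, q, b; 2 * ϖ * r, s, r; 4 * ϖ ^ 2 * b, 2 * ϖ * q, 1 + 2 * ϖ * b]) :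
    (⟨t, htS⟩ : ↥(MulAction.stabilizer (↥(unitaryGroupOfForm σ J)) (![1, 0, -(2 * ϖ)] : Fin 3 → K))) •
        (QuotientGroup.mk h : ↥(MulAction.stabilizer (↥(unitaryGroupOfForm σ J)) (![1, 0, -(2 * ϖ)] : Fin 3 → K)) ⧸
          ((unitaryInt σ J).map (MulAut.conj (d m)).toMonoidHom).subgroupOf
            (MulAction.stabilizer (↥(unitaryGroupOfForm σ J)) (![1, 0, -(2 * ϖ)] : Fin 3 → K))) = QuotientGroup.mk h ↔
      m ≤ N ∧ Valued.v (((1 + 4 * ϖ * bt) - 1) - 4 * ϖ * ((1 + 4 * ϖ * bt) - st) * (σ q * q) -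
        4 * ϖ * (qt * σ q * s - (1 + 4 * ϖ * bt) / σ st * (σ qt * q * σ s))) ≤ Valued.v (ϖ ^ (2 * m + 1)) := by
  obtain ⟨hs1, hq1, -, -⟩ := stabilizer_valuation_bounds σ hJ hd hh
  have hrt : Valued.v rt = WithZero.exp (-(N : ℤ)) := by rw [stabilizer_v_r_eq_v_q σ hJ hd ht, hqt]
  rw [smul_mk_eq_iff_flickerDiag σ d m ⟨t, htS⟩ h]
  change ((h : ↥(unitaryGroupOfForm σ J)) * d m)⁻¹ * t * ((h : ↥(unitaryGroupOfForm σ J)) * d m) ∈ unitaryInt σ J ↔ _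
  rw [fixedPoint_mem_unitaryInt_iff σ hJ hd m hdm ht hh, fixedPoint_cond01_iff σ hd hs1 hq1 N m hqt hrt hAst,
    v_fixedPoint_expr00_eq_v_bracket σ hJ hd ht hh]

/-! ## §3 The counts: `0` for `m > N`; all-or-none for `2m ≤ N` -/

set_option synthInstance.maxHeartbeats 200000 in
-- as above
include hJ in
/-- **PROP. 16, TAIL**: for `m > N` NO coset of `S ⧸ H′_m` is fixed by a type-(2) `t` with `|q_t| = |ϖ|^N` («which means `0 ≤ m ≤ N`»):
`#{z ∈ S ⧸ H′_m : t • z = z} = 0`. [cite: Flicker1998UnitaryFL, Prop. 16 p. 96] -/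
theorem natCard_fixedPoints_stabilizer_quotient_eq_zero_of_lt (hd : LocalConjDatum σ ϖ) (d : ℕ → ↥(unitaryGroupOfForm σ J)) (m : ℕ)
    (hdm : ((d m : GL (Fin 3) K) : Matrix (Fin 3) (Fin 3) K) = !![ϖ ^ m, 0, 0; 0, 1, 0; 0, 0, (ϖ ^ m)⁻¹])
    {t : ↥(unitaryGroupOfForm σ J)} (htS : t ∈ MulAction.stabilizer (↥(unitaryGroupOfForm σ J)) (![1, 0, -(2 * ϖ)] : Fin 3 → K))
    {bt qt rt st : K}
    (ht : ((t : GL (Fin 3) K) : Matrix (Fin 3) (Fin 3) K) =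
      !![1 + 2 * ϖ * bt, qt, bt; 2 * ϖ * rt, st, rt; 4 * ϖ ^ 2 * bt, 2 * ϖ * qt, 1 + 2 * ϖ * bt])
    (N : ℕ) (hqt : Valued.v qt = WithZero.exp (-(N : ℤ))) (hAst : Valued.v ((1 + 4 * ϖ * bt) - st) ≤ WithZero.exp (-((N : ℤ) + 1)))
    (hNm : N < m) :
    Nat.card {z : ↥(MulAction.stabilizer (↥(unitaryGroupOfForm σ J)) (![1, 0, -(2 * ϖ)] : Fin 3 → K)) ⧸
          ((unitaryInt σ J).map (MulAut.conj (d m)).toMonoidHom).subgroupOf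
            (MulAction.stabilizer (↥(unitaryGroupOfForm σ J)) (![1, 0, -(2 * ϖ)] : Fin 3 → K)) |
        (⟨t, htS⟩ : ↥(MulAction.stabilizer (↥(unitaryGroupOfForm σ J)) (![1, 0, -(2 * ϖ)] : Fin 3 → K))) • z = z} = 0 := by
  haveI : IsEmpty {z : ↥(MulAction.stabilizer (↥(unitaryGroupOfForm σ J)) (![1, 0, -(2 * ϖ)] : Fin 3 → K)) ⧸
          ((unitaryInt σ J).map (MulAut.conj (d m)).toMonoidHom).subgroupOf
            (MulAction.stabilizer (↥(unitaryGroupOfForm σ J)) (![1, 0, -(2 * ϖ)] : Fin 3 → K)) |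
        (⟨t, htS⟩ : ↥(MulAction.stabilizer (↥(unitaryGroupOfForm σ J)) (![1, 0, -(2 * ϖ)] : Fin 3 → K))) • z = z} := by
    refine ⟨fun ⟨z, hz⟩ => ?_⟩
    induction z using QuotientGroup.induction_on with
    | H h =>
      obtain ⟨b, q, r, s, hh⟩ := exists_coe_eq_of_mulVec_anisoVec_eq σ hJ hd
        ((mem_stabilizer_anisoVec_iff σ _ (h : ↥(unitaryGroupOfForm σ J))).1 h.2)
      have hfix := (smul_mk_eq_mk_iff_le_and_cond00 σ hJ hd d m hdm htS ht N hqt hAst h hh).1 hz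
      omega
  exact Nat.card_of_isEmpty

set_option synthInstance.maxHeartbeats 200000 in
-- as above
include hJ in
/-- **PROP. 16, FIRST ROW (all or none)**: for `2m ≤ N` the fixed-point condition does not depend on the coset — every coset of `S ⧸ H′_m` is `t`-fixed when
`|A_t − 1| ≤ |ϖ^{2m+1}|` (Flicker: `m ≤ [N₂∕2]`), none otherwise:
`#{z ∈ S ⧸ H′_m : t • z = z} = if |A_t − 1| ≤ |ϖ^{2m+1}| then #(S ⧸ H′_m) else 0` (and `#(S ⧸ H′_m) = (q+1)q^{4m}`, FILE 2e-β).
[cite: Flicker1998UnitaryFL, Prop. 16 p. 96] -/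
theorem natCard_fixedPoints_stabilizer_quotient_eq_ite_of_two_mul_le (hd : LocalConjDatum σ ϖ) (d : ℕ → ↥(unitaryGroupOfForm σ J)) (m : ℕ)
    (hdm : ((d m : GL (Fin 3) K) : Matrix (Fin 3) (Fin 3) K) = !![ϖ ^ m, 0, 0; 0, 1, 0; 0, 0, (ϖ ^ m)⁻¹])
    {t : ↥(unitaryGroupOfForm σ J)} (htS : t ∈ MulAction.stabilizer (↥(unitaryGroupOfForm σ J)) (![1, 0, -(2 * ϖ)] : Fin 3 → K))
    {bt qt rt st : K}
    (ht : ((t : GL (Fin 3) K) : Matrix (Fin 3) (Fin 3) K) =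
      !![1 + 2 * ϖ * bt, qt, bt; 2 * ϖ * rt, st, rt; 4 * ϖ ^ 2 * bt, 2 * ϖ * qt, 1 + 2 * ϖ * bt])
    (N : ℕ) (hqt : Valued.v qt = WithZero.exp (-(N : ℤ))) (hAst : Valued.v ((1 + 4 * ϖ * bt) - st) ≤ WithZero.exp (-((N : ℤ) + 1)))
    (hmN : 2 * m ≤ N) :
    Nat.card {z : ↥(MulAction.stabilizer (↥(unitaryGroupOfForm σ J)) (![1, 0, -(2 * ϖ)] : Fin 3 → K)) ⧸
          ((unitaryInt σ J).map (MulAut.conj (d m)).toMonoidHom).subgroupOf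
            (MulAction.stabilizer (↥(unitaryGroupOfForm σ J)) (![1, 0, -(2 * ϖ)] : Fin 3 → K)) |
        (⟨t, htS⟩ : ↥(MulAction.stabilizer (↥(unitaryGroupOfForm σ J)) (![1, 0, -(2 * ϖ)] : Fin 3 → K))) • z = z} =
      if Valued.v ((1 + 4 * ϖ * bt) - 1) ≤ Valued.v (ϖ ^ (2 * m + 1)) then
        Nat.card (↥(MulAction.stabilizer (↥(unitaryGroupOfForm σ J)) (![1, 0, -(2 * ϖ)] : Fin 3 → K)) ⧸
          ((unitaryInt σ J).map (MulAut.conj (d m)).toMonoidHom).subgroupOf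
            (MulAction.stabilizer (↥(unitaryGroupOfForm σ J)) (![1, 0, -(2 * ϖ)] : Fin 3 → K)))
      else 0 := by
  obtain ⟨hst1, hqt1, hAt1, -⟩ := stabilizer_valuation_bounds σ hJ hd ht
  -- the pointwise criterion, with condition 2 made `h`-independent by ★ (ii-b)
  have hpt : ∀ z : ↥(MulAction.stabilizer (↥(unitaryGroupOfForm σ J)) (![1, 0, -(2 * ϖ)] : Fin 3 → K)) ⧸
          ((unitaryInt σ J).map (MulAut.conj (d m)).toMonoidHom).subgroupOf
            (MulAction.stabilizer (↥(unitaryGroupOfForm σ J)) (![1, 0, -(2 * ϖ)] : Fin 3 → K)),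
      (⟨t, htS⟩ : ↥(MulAction.stabilizer (↥(unitaryGroupOfForm σ J)) (![1, 0, -(2 * ϖ)] : Fin 3 → K))) • z = z ↔
        Valued.v ((1 + 4 * ϖ * bt) - 1) ≤ Valued.v (ϖ ^ (2 * m + 1)) := by
    intro z
    induction z using QuotientGroup.induction_on with
    | H h =>
      obtain ⟨b, q, r, s, hh⟩ := exists_coe_eq_of_mulVec_anisoVec_eq σ hJ hd
        ((mem_stabilizer_anisoVec_iff σ _ (h : ↥(unitaryGroupOfForm σ J))).1 h.2)
      obtain ⟨hs1, hq1, -, -⟩ := stabilizer_valuation_bounds σ hJ hd hh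
      rw [smul_mk_eq_mk_iff_le_and_cond00 σ hJ hd d m hdm htS ht N hqt hAst h hh,
        fixedPoint_cond00_iff_of_two_mul_le σ hd hs1 hq1 hAt1 hst1 N m hmN hqt hAst]
      exact ⟨fun H => H.2, fun H => ⟨by omega, H⟩⟩
  split_ifs with hc
  · exact Nat.card_congr (Equiv.subtypeUnivEquiv fun z => (hpt z).2 hc)
  · haveI : IsEmpty {z : ↥(MulAction.stabilizer (↥(unitaryGroupOfForm σ J)) (![1, 0, -(2 * ϖ)] : Fin 3 → K)) ⧸
          ((unitaryInt σ J).map (MulAut.conj (d m)).toMonoidHom).subgroupOf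
            (MulAction.stabilizer (↥(unitaryGroupOfForm σ J)) (![1, 0, -(2 * ϖ)] : Fin 3 → K)) |
        (⟨t, htS⟩ : ↥(MulAction.stabilizer (↥(unitaryGroupOfForm σ J)) (![1, 0, -(2 * ϖ)] : Fin 3 → K))) • z = z} :=
      ⟨fun ⟨z, hz⟩ => hc ((hpt z).1 hz)⟩
    exact Nat.card_of_isEmpty

/-! ## §4 The case `M ≤ N` (`|A_t − 1| > |ϖ|^{N+1}`): again all or none, for every `m` -/

/-- The bracket differs from `A_t − 1` by terms of valuation `≤ |ϖ|^{N+1}`: `|bracket − (A_t − 1)| ≤ |ϖ|^{N+1}` for every `h ∈ S` (`|q| ≤ 1`, `|s| = 1`).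
[cite: Flicker1998UnitaryFL, Prop. 16 p. 96] -/
theorem v_bracket_sub_sub_le (hd : LocalConjDatum σ ϖ) {At st qt s q : K} (hs : Valued.v s = 1) (hq : Valued.v q ≤ 1)
    (hAt : Valued.v At = 1) (hst1 : Valued.v st = 1) (N : ℕ)
    (hqt : Valued.v qt = WithZero.exp (-(N : ℤ))) (hAst : Valued.v (At - st) ≤ WithZero.exp (-((N : ℤ) + 1))) :
    Valued.v (((At - 1) - 4 * ϖ * (At - st) * (σ q * q) - 4 * ϖ * (qt * σ q * s - At / σ st * (σ qt * q * σ s))) - (At - 1)) ≤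
      WithZero.exp (-((N : ℤ) + 1)) := by
  have hvσ := hd.vσ
  have h4 : Valued.v (4 : K) = 1 := by rw [show (4 : K) = 2 * 2 by norm_num, map_mul, hd.v2, one_mul]
  have hσq : Valued.v (σ q) ≤ 1 := by rw [hvσ]; exact hq
  have h1 : Valued.v (4 * ϖ * (At - st) * (σ q * q)) ≤ WithZero.exp (-((N : ℤ) + 1)) := by
    rw [map_mul, map_mul, map_mul, map_mul, h4, one_mul, hd.vϖ]
    calc WithZero.exp (-1 : ℤ) * Valued.v (At - st) * (Valued.v (σ q) * Valued.v q)
        ≤ 1 * WithZero.exp (-((N : ℤ) + 1)) * (1 * 1) := by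
          refine mul_le_mul' (mul_le_mul' ?_ hAst) (mul_le_mul' hσq hq)
          rw [← WithZero.exp_zero, WithZero.exp_le_exp]; norm_num
      _ = WithZero.exp (-((N : ℤ) + 1)) := by rw [one_mul, mul_one, mul_one]
  have h2 : Valued.v (4 * ϖ * (qt * σ q * s - At / σ st * (σ qt * q * σ s))) ≤ WithZero.exp (-((N : ℤ) + 1)) := by
    rw [map_mul, map_mul, h4, one_mul, hd.vϖ, show -((N : ℤ) + 1) = -1 + -(N : ℤ) by ring, WithZero.exp_add]
    refine mul_le_mul' le_rfl (Valuation.map_sub_le _ ?_ ?_)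
    · rw [map_mul, map_mul, hqt, hs, mul_one]
      calc WithZero.exp (-(N : ℤ)) * Valued.v (σ q) ≤ WithZero.exp (-(N : ℤ)) * 1 := mul_le_mul' le_rfl hσq
        _ = _ := mul_one _
    · rw [map_mul, map_div₀, hAt, hvσ, hst1, div_one, one_mul, map_mul, map_mul, hvσ, hqt, hvσ, hs, mul_one]
      calc WithZero.exp (-(N : ℤ)) * Valued.v q ≤ WithZero.exp (-(N : ℤ)) * 1 := mul_le_mul' le_rfl hq
        _ = _ := mul_one _
  have hre : ((At - 1) - 4 * ϖ * (At - st) * (σ q * q) - 4 * ϖ * (qt * σ q * s - At / σ st * (σ qt * q * σ s))) - (At - 1) =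
      -(4 * ϖ * (At - st) * (σ q * q)) - 4 * ϖ * (qt * σ q * s - At / σ st * (σ qt * q * σ s)) := by ring
  rw [hre]
  exact Valuation.map_sub_le _ (by rwa [Valuation.map_neg]) h2

/-- **Condition 2 when `|A_t − 1| > |ϖ|^{N+1}`** (Flicker: `N₂ < N`, i.e. `M ≤ N`): the bracket has valuation EXACTLY `|A_t − 1|` for every `h`, so condition 2
`⟺ |A_t − 1| ≤ |ϖ^{2m+1}|` (h-independent, every `m`). [cite: Flicker1998UnitaryFL, Prop. 16 p. 96 (the rows with `N₂ < N`)] -/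
theorem fixedPoint_cond00_iff_of_lt_v_sub_one (hd : LocalConjDatum σ ϖ) {At st qt s q : K} (hs : Valued.v s = 1) (hq : Valued.v q ≤ 1)
    (hAt : Valued.v At = 1) (hst1 : Valued.v st = 1) (N m : ℕ)
    (hqt : Valued.v qt = WithZero.exp (-(N : ℤ))) (hAst : Valued.v (At - st) ≤ WithZero.exp (-((N : ℤ) + 1)))
    (hM : WithZero.exp (-((N : ℤ) + 1)) < Valued.v (At - 1)) :
    Valued.v ((At - 1) - 4 * ϖ * (At - st) * (σ q * q) - 4 * ϖ * (qt * σ q * s - At / σ st * (σ qt * q * σ s))) ≤ Valued.v (ϖ ^ (2 * m + 1)) ↔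
      Valued.v (At - 1) ≤ Valued.v (ϖ ^ (2 * m + 1)) := by
  have hy := v_bracket_sub_sub_le σ hd hs hq hAt hst1 N hqt hAst
  have heq : Valued.v ((At - 1) - 4 * ϖ * (At - st) * (σ q * q) - 4 * ϖ * (qt * σ q * s - At / σ st * (σ qt * q * σ s))) =
      Valued.v (At - 1) := by
    have hre : (At - 1) - 4 * ϖ * (At - st) * (σ q * q) - 4 * ϖ * (qt * σ q * s - At / σ st * (σ qt * q * σ s)) =
        (At - 1) + ((((At - 1) - 4 * ϖ * (At - st) * (σ q * q) - 4 * ϖ * (qt * σ q * s - At / σ st * (σ qt * q * σ s))) - (At - 1))) := by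
      ring
    rw [hre]
    exact Valuation.map_add_eq_of_lt_left _ (lt_of_le_of_lt hy hM)
  rw [heq]

set_option synthInstance.maxHeartbeats 200000 in
-- as above
include hJ in
/-- **PROP. 16, THE ROWS `N₂ < N` (all or none, every `m`)**: for `t ∈ S` of type-(2) sizes with `|A_t − 1| > |ϖ|^{N+1}` (`M = ord(A_t − 1) ≤ N`):
`#{z ∈ S ⧸ H′_m : t • z = z} = if m ≤ N ∧ |A_t − 1| ≤ |ϖ^{2m+1}| then #(S ⧸ H′_m) else 0` — i.e. `(q+1)q^{4m}` for `2m + 1 ≤ M` and `0` beyond (Prop. 16 with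
`min([N∕2],[N₂∕2]) = [N₂∕2]`; the second row is empty since `N < M` fails). [cite: Flicker1998UnitaryFL, Prop. 16 p. 96] -/
theorem natCard_fixedPoints_stabilizer_quotient_eq_ite_of_lt_v_sub_one (hd : LocalConjDatum σ ϖ) (d : ℕ → ↥(unitaryGroupOfForm σ J)) (m : ℕ)
    (hdm : ((d m : GL (Fin 3) K) : Matrix (Fin 3) (Fin 3) K) = !![ϖ ^ m, 0, 0; 0, 1, 0; 0, 0, (ϖ ^ m)⁻¹])
    {t : ↥(unitaryGroupOfForm σ J)} (htS : t ∈ MulAction.stabilizer (↥(unitaryGroupOfForm σ J)) (![1, 0, -(2 * ϖ)] : Fin 3 → K))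
    {bt qt rt st : K}
    (ht : ((t : GL (Fin 3) K) : Matrix (Fin 3) (Fin 3) K) =
      !![1 + 2 * ϖ * bt, qt, bt; 2 * ϖ * rt, st, rt; 4 * ϖ ^ 2 * bt, 2 * ϖ * qt, 1 + 2 * ϖ * bt])
    (N : ℕ) (hqt : Valued.v qt = WithZero.exp (-(N : ℤ))) (hAst : Valued.v ((1 + 4 * ϖ * bt) - st) ≤ WithZero.exp (-((N : ℤ) + 1)))
    (hM : WithZero.exp (-((N : ℤ) + 1)) < Valued.v ((1 + 4 * ϖ * bt) - 1)) :
    Nat.card {z : ↥(MulAction.stabilizer (↥(unitaryGroupOfForm σ J)) (![1, 0, -(2 * ϖ)] : Fin 3 → K)) ⧸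
          ((unitaryInt σ J).map (MulAut.conj (d m)).toMonoidHom).subgroupOf
            (MulAction.stabilizer (↥(unitaryGroupOfForm σ J)) (![1, 0, -(2 * ϖ)] : Fin 3 → K)) |
        (⟨t, htS⟩ : ↥(MulAction.stabilizer (↥(unitaryGroupOfForm σ J)) (![1, 0, -(2 * ϖ)] : Fin 3 → K))) • z = z} =
      if m ≤ N ∧ Valued.v ((1 + 4 * ϖ * bt) - 1) ≤ Valued.v (ϖ ^ (2 * m + 1)) then
        Nat.card (↥(MulAction.stabilizer (↥(unitaryGroupOfForm σ J)) (![1, 0, -(2 * ϖ)] : Fin 3 → K)) ⧸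
          ((unitaryInt σ J).map (MulAut.conj (d m)).toMonoidHom).subgroupOf
            (MulAction.stabilizer (↥(unitaryGroupOfForm σ J)) (![1, 0, -(2 * ϖ)] : Fin 3 → K)))
      else 0 := by
  obtain ⟨hst1, hqt1, hAt1, -⟩ := stabilizer_valuation_bounds σ hJ hd ht
  have hpt : ∀ z : ↥(MulAction.stabilizer (↥(unitaryGroupOfForm σ J)) (![1, 0, -(2 * ϖ)] : Fin 3 → K)) ⧸
          ((unitaryInt σ J).map (MulAut.conj (d m)).toMonoidHom).subgroupOf
            (MulAction.stabilizer (↥(unitaryGroupOfForm σ J)) (![1, 0, -(2 * ϖ)] : Fin 3 → K)),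
      (⟨t, htS⟩ : ↥(MulAction.stabilizer (↥(unitaryGroupOfForm σ J)) (![1, 0, -(2 * ϖ)] : Fin 3 → K))) • z = z ↔
        m ≤ N ∧ Valued.v ((1 + 4 * ϖ * bt) - 1) ≤ Valued.v (ϖ ^ (2 * m + 1)) := by
    intro z
    induction z using QuotientGroup.induction_on with
    | H h =>
      obtain ⟨b, q, r, s, hh⟩ := exists_coe_eq_of_mulVec_anisoVec_eq σ hJ hd
        ((mem_stabilizer_anisoVec_iff σ _ (h : ↥(unitaryGroupOfForm σ J))).1 h.2)
      obtain ⟨hs1, hq1, -, -⟩ := stabilizer_valuation_bounds σ hJ hd hh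
      rw [smul_mk_eq_mk_iff_le_and_cond00 σ hJ hd d m hdm htS ht N hqt hAst h hh,
        fixedPoint_cond00_iff_of_lt_v_sub_one σ hd hs1 hq1 hAt1 hst1 N m hqt hAst hM]
  split_ifs with hc
  · exact Nat.card_congr (Equiv.subtypeUnivEquiv fun z => (hpt z).2 hc)
  · haveI : IsEmpty {z : ↥(MulAction.stabilizer (↥(unitaryGroupOfForm σ J)) (![1, 0, -(2 * ϖ)] : Fin 3 → K)) ⧸
          ((unitaryInt σ J).map (MulAut.conj (d m)).toMonoidHom).subgroupOf
            (MulAction.stabilizer (↥(unitaryGroupOfForm σ J)) (![1, 0, -(2 * ϖ)] : Fin 3 → K)) |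
        (⟨t, htS⟩ : ↥(MulAction.stabilizer (↥(unitaryGroupOfForm σ J)) (![1, 0, -(2 * ϖ)] : Fin 3 → K))) • z = z} :=
      ⟨fun ⟨z, hz⟩ => hc ((hpt z).1 hz)⟩
    exact Nat.card_of_isEmpty

end UnitaryGroup

end Literature.NumberTheory.Automorphic

end
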